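import Mathlib
import Literature.Probability.LatticeModels.SRWKilledWalkFunctionals
import HarnessLib

/-!
# Exit decomposition of the killed Green function and the ratio maximum principle

Topic `Literature/Probability/LatticeModels`; companion of `SRWKilledWalkFunctionals.lean`
(`SRW.killedTrans`, `SRW.killedGreen`: the simple random walk of `ℤ^d` run along the edges of a
graph `Gr` and killed at its first non-`Gr` step). Everything here is PROVED and [folklore]
(Lawler 1991, §1.4–1.5; Lawler–Limic 2010, §4.6, the strong Markov property at the exit time of a
set, "`G_A(x,y) = Σ_z P^x{S_τ = z} G_A(z,y)`"; Kozdron–Lawler 2005, §2.3): for a finite vertex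
set `W` and a target `q ∉ W`, every `Gr`-walk from `p ∈ W` to `q` leaves `W`, and splitting it at
its first vertex outside `W` gives

* `killedTrans_eq_sum_firstExit` — the finite-time form
  `p_n(p,q) = Σ_{k ≤ n} Σ_{y ∈ exitSet W} f_k(p,y) p_{n-k}(y,q)`, where the **first-exit weights**
  `f_k(p,y) = firstExit Gr W k p y` (the probability that the killed walk from `p` makes `k`
  `Gr`-steps, the first `k` positions lying in `W`, and sits at `y ∉ W` at time `k`) are DEFINED by
  their first-step recursion (`firstExit`), which is all the proofs use, and `exitSet W` is the set
  of lattice neighbours of `W` outside `W`;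
* `killedGreen_eq_sum_firstExitKernel` — summing over `n` (Cauchy product of nonnegative summable
  series, on a graph with finitely many non-isolated vertices):
  `G(p,q) = Σ_{y ∈ exitSet W} F_W(p,y) G(y,q)`, `F_W(p,y) = Σ_k f_k(p,y)` (`firstExitKernel`);
* `killedGreen_le_mul_of_forall_exit`, `mul_killedGreen_le_of_forall_exit` — the **ratio maximum
  principle**: if `G(y,q₁) ≤ M G(y,q₂)` (resp. `m G(y,q₂) ≤ G(y,q₁)`) for all exit points
  `y ∈ exitSet W`, then the same holds at every `p ∈ W`. This is the form in which the discrete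
  boundary Harnack principle is iterated (oscillation of `G(·,q₁)/G(·,q₂)` over a ball is attained
  on its exit set).

Probabilities are real numbers, as in `SRWKilledWalkFunctionals.lean`; the identification of
`firstExit` with the path-space probability of the first-exit event is not needed here and not
proved.

## References
* G. F. Lawler, *Intersections of Random Walks* (1991), §1.4–1.5. [Lawler1991]
* G. F. Lawler, V. Limic, *Random Walk: A Modern Introduction* (2010), §4.6. [LawlerLimic2010]
* M. J. Kozdron, G. F. Lawler, Electron. J. Probab. 10 (2005), §2.3. [KozdronLawler2005]
-/

noncomputable section

open Finset
open scoped Classical BigOperators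

namespace Literature.Probability.LatticeModels

namespace SRW

variable {d : ℕ}

/-! ### The exit set of a finite vertex set -/

/-- The **exit set** of a finite vertex set `W ⊆ ℤ^d`: the lattice neighbours `p ± eᵢ` of points
`p ∈ W` that are not in `W` (the possible positions of a nearest-neighbour walk from `W` at its
first time outside `W`). [folklore] -/
def exitSet (W : Finset (Site d)) : Finset (Site d) :=
  (W.biUnion fun p => (Finset.univ : Finset (Dir d)).image fun e => p + stepVec e) \ W

/-- Membership in the exit set. [folklore] -/
theorem mem_exitSet {W : Finset (Site d)} {y : Site d} :
    y ∈ exitSet W ↔ (∃ p ∈ W, ∃ e : Dir d, p + stepVec e = y) ∧ y ∉ W := by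
  simp [exitSet]

/-- Points of the exit set are outside `W`. [folklore] -/
theorem not_mem_of_mem_exitSet {W : Finset (Site d)} {y : Site d} (hy : y ∈ exitSet W) : y ∉ W :=
  (mem_exitSet.1 hy).2

/-- A lattice neighbour of a point of `W` outside `W` is an exit point. [folklore] -/
theorem add_stepVec_mem_exitSet {W : Finset (Site d)} {p : Site d} (hp : p ∈ W) (e : Dir d)
    (h : p + stepVec e ∉ W) : p + stepVec e ∈ exitSet W :=
  mem_exitSet.2 ⟨⟨p, hp, e, rfl⟩, h⟩

/-! ### First-exit weights, by the first-step recursion -/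

/-- The **first-exit weights** `f_k(p,y)` of the walk run along `Gr` and killed at its first
non-`Gr` step, relative to the finite vertex set `W`: `f_0(p,y) = [p ∉ W, p = y]`,
`f_{k+1}(p,y) = [p ∈ W] (2d)⁻¹ Σ_e [p ~ p+e in Gr] f_k(p+e,y)`. For `p ∈ W` and `y ∉ W` this is
the probability that the walk from `p` makes `k` `Gr`-steps with positions `0,…,k-1` in `W` and
position `k` equal to `y` (first exit from `W` at time `k`, at `y`); only the recursion is used
below. [folklore] -/
def firstExit (Gr : SimpleGraph (Site d)) (W : Finset (Site d)) : ℕ → Site d → Site d → ℝ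
  | 0, p, y => if p ∉ W ∧ p = y then 1 else 0
  | k + 1, p, y => if p ∈ W then (2 * d : ℝ)⁻¹ *
      ∑ e : Dir d, (if Gr.Adj p (p + stepVec e) then firstExit Gr W k (p + stepVec e) y else 0)
      else 0

/-- `f_0(p,y) = [p ∉ W, p = y]`. [folklore] -/
theorem firstExit_zero (Gr : SimpleGraph (Site d)) (W : Finset (Site d)) (p y : Site d) :
    firstExit Gr W 0 p y = if p ∉ W ∧ p = y then 1 else 0 := rfl

/-- The recursion at a point of `W`. [folklore] -/
theorem firstExit_succ_of_mem (Gr : SimpleGraph (Site d)) {W : Finset (Site d)} {p : Site d}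
    (hp : p ∈ W) (k : ℕ) (y : Site d) :
    firstExit Gr W (k + 1) p y = (2 * d : ℝ)⁻¹ *
      ∑ e : Dir d, (if Gr.Adj p (p + stepVec e) then firstExit Gr W k (p + stepVec e) y else 0) := by
  simp only [firstExit, if_pos hp]

/-- At a point of `W` there is no exit at time `0`. [folklore] -/
theorem firstExit_zero_of_mem (Gr : SimpleGraph (Site d)) {W : Finset (Site d)} {p : Site d}
    (hp : p ∈ W) (y : Site d) : firstExit Gr W 0 p y = 0 := by
  simp [firstExit_zero, hp]

/-- Outside `W` the walk has already exited: `f_k(p,y) = [k = 0, p = y]`. [folklore] -/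
theorem firstExit_of_not_mem (Gr : SimpleGraph (Site d)) {W : Finset (Site d)} {p : Site d}
    (hp : p ∉ W) (k : ℕ) (y : Site d) :
    firstExit Gr W k p y = if k = 0 ∧ p = y then 1 else 0 := by
  cases k with
  | zero => simp [firstExit_zero, hp]
  | succ k => simp [firstExit, hp]

/-- The first-exit weights are nonnegative. [folklore] -/
theorem firstExit_nonneg (Gr : SimpleGraph (Site d)) (W : Finset (Site d)) (k : ℕ) (p y : Site d) :
    0 ≤ firstExit Gr W k p y := by
  induction k generalizing p with
  | zero => rw [firstExit_zero]; split_ifs <;> norm_num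
  | succ k ih =>
    by_cases hp : p ∈ W
    · rw [firstExit_succ_of_mem Gr hp]
      refine mul_nonneg (by positivity) (Finset.sum_nonneg fun e _ => ?_)
      split_ifs
      · exact ih _
      · exact le_rfl
    · rw [firstExit_of_not_mem Gr hp]; split_ifs <;> norm_num

/-- The first-exit weights are dominated by the transition function of the killed walk:
`f_k(p,y) ≤ p_k(p,y)`. [folklore] -/
theorem firstExit_le_killedTrans [NeZero d] (Gr : SimpleGraph (Site d)) (W : Finset (Site d))
    (k : ℕ) (p y : Site d) : firstExit Gr W k p y ≤ killedTrans Gr k p y := by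
  induction k generalizing p with
  | zero =>
    rw [firstExit_zero, killedTrans_zero]
    by_cases hpy : p = y
    · simp only [hpy, and_true, if_true]
      split_ifs <;> norm_num
    · simp [hpy]
  | succ k ih =>
    by_cases hp : p ∈ W
    · rw [firstExit_succ_of_mem Gr hp, killedTrans_succ]
      refine mul_le_mul_of_nonneg_left (Finset.sum_le_sum fun e _ => ?_) (by positivity)
      split_ifs
      · exact ih _
      · exact le_rfl
    · rw [firstExit_of_not_mem Gr hp]
      simp only [Nat.succ_ne_zero, false_and, if_false]
      exact killedTrans_nonneg Gr _ _ _

/-- From a point of `W`, the walk can only exit at a point of the exit set: `f_k(p,y) = 0` for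
`p ∈ W`, `y ∉ exitSet W`. [folklore] -/
theorem firstExit_eq_zero_of_not_mem_exitSet (Gr : SimpleGraph (Site d)) {W : Finset (Site d)}
    {y : Site d} (hy : y ∉ exitSet W) : ∀ (k : ℕ) {p : Site d}, p ∈ W → firstExit Gr W k p y = 0 := by
  intro k
  induction k with
  | zero => intro p hp; exact firstExit_zero_of_mem Gr hp y
  | succ k ih =>
    intro p hp
    rw [firstExit_succ_of_mem Gr hp]
    refine mul_eq_zero_of_right _ (Finset.sum_eq_zero fun e _ => ?_)
    split_ifs with hadj
    · by_cases h : p + stepVec e ∈ W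
      · exact ih h
      · rw [firstExit_of_not_mem Gr h]
        split_ifs with h0
        · exact absurd (h0.2 ▸ add_stepVec_mem_exitSet hp e h) hy
        · rfl
    · rfl

/-! ### The exit decomposition at finite times -/

/-- Outside `W` the decomposition is the trivial one (only `k = 0`, `y = p` contributes).
[folklore] -/
theorem killedTrans_eq_sum_firstExit_of_not_mem [NeZero d] (Gr : SimpleGraph (Site d))
    {W : Finset (Site d)} {p : Site d} (hp : p ∉ W) (hpe : p ∈ exitSet W) (n : ℕ) (q : Site d) :
    killedTrans Gr n p q =
      ∑ k ∈ range (n + 1), ∑ y ∈ exitSet W, firstExit Gr W k p y * killedTrans Gr (n - k) y q := by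
  rw [Finset.sum_eq_single_of_mem 0 (by simp)]
  · simp_rw [firstExit_of_not_mem Gr hp, true_and, Nat.sub_zero, ite_mul, one_mul, zero_mul]
    rw [Finset.sum_ite_eq, if_pos hpe]
  · intro k _ hk
    refine Finset.sum_eq_zero fun y _ => ?_
    rw [firstExit_of_not_mem Gr hp, if_neg (fun h => hk h.1), zero_mul]

/-- **Exit decomposition at finite times.** For a finite vertex set `W`, a target `q ∉ W`, and a
starting point `p` in `W` or in its exit set,
`p_n(p,q) = Σ_{k ≤ n} Σ_{y ∈ exitSet W} f_k(p,y) p_{n-k}(y,q)`: a `Gr`-walk from `p` to `q` is split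
at its first vertex outside `W`. Proof by induction on `n` from the first-step equations of both
sides (`killedTrans_succ` and the recursion defining `firstExit`). [folklore] -/
theorem killedTrans_eq_sum_firstExit [NeZero d] (Gr : SimpleGraph (Site d)) {W : Finset (Site d)}
    {q : Site d} (hq : q ∉ W) :
    ∀ (n : ℕ) (p : Site d), (p ∈ W ∨ p ∈ exitSet W) →
      killedTrans Gr n p q =
        ∑ k ∈ range (n + 1), ∑ y ∈ exitSet W, firstExit Gr W k p y * killedTrans Gr (n - k) y q := by
  intro n
  induction n with
  | zero =>
    intro p hpW
    by_cases hp : p ∈ W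
    · have hpq : p ≠ q := fun h => hq (h ▸ hp)
      rw [killedTrans_zero, if_neg hpq]
      simp [firstExit_zero_of_mem Gr hp]
    · exact killedTrans_eq_sum_firstExit_of_not_mem Gr hp (hpW.resolve_left hp) 0 q
  | succ n ih =>
    intro p hpW
    by_cases hp : p ∈ W
    · -- left-hand side: first step, then the induction hypothesis at the neighbours
      rw [killedTrans_succ]
      have hL : ∀ e : Dir d,
          (if Gr.Adj p (p + stepVec e) then killedTrans Gr n (p + stepVec e) q else 0) =
            ∑ k ∈ range (n + 1), ∑ y ∈ exitSet W,
              (if Gr.Adj p (p + stepVec e) then firstExit Gr W k (p + stepVec e) y else 0) *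
                killedTrans Gr (n - k) y q := by
        intro e
        split_ifs with hadj
        · have hmem : p + stepVec e ∈ W ∨ p + stepVec e ∈ exitSet W := by
            by_cases h : p + stepVec e ∈ W
            · exact Or.inl h
            · exact Or.inr (add_stepVec_mem_exitSet hp e h)
          exact ih (p + stepVec e) hmem
        · simp
      simp_rw [hL]
      -- right-hand side: peel off `k = 0` (no exit at time 0 from `p ∈ W`) and shift
      rw [Finset.sum_range_succ' (fun k => ∑ y ∈ exitSet W,
        firstExit Gr W k p y * killedTrans Gr (n + 1 - k) y q)]
      simp_rw [firstExit_zero_of_mem Gr hp, zero_mul, Finset.sum_const_zero, add_zero,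
        Nat.add_sub_add_right, firstExit_succ_of_mem Gr hp]
      -- both sides are now `(2d)⁻¹ Σ_k Σ_y Σ_e …` up to the order of summation
      simp_rw [mul_assoc, Finset.sum_mul, ← Finset.mul_sum]
      congr 1
      rw [Finset.sum_comm]
      exact Finset.sum_congr rfl fun k _ => Finset.sum_comm
    · exact killedTrans_eq_sum_firstExit_of_not_mem Gr hp (hpW.resolve_left hp) (n + 1) q

/-! ### The exit decomposition of the killed Green function -/

/-- The **first-exit kernel** `F_W(p,y) = Σ_k f_k(p,y)`: for `p ∈ W`, `y ∉ W` the probability that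
the killed walk from `p` leaves `W` (before being killed) and does so at `y`. [folklore] -/
def firstExitKernel (Gr : SimpleGraph (Site d)) (W : Finset (Site d)) (p y : Site d) : ℝ :=
  ∑' k : ℕ, firstExit Gr W k p y

/-- The first-exit weights are summable in time on a graph with finitely many non-isolated
vertices (domination by the transition function). [folklore] -/
theorem summable_firstExit [NeZero d] {Gr : SimpleGraph (Site d)} (hfin : Gr.support.Finite)
    (W : Finset (Site d)) (p y : Site d) : Summable fun k => firstExit Gr W k p y :=
  (summable_killedTrans_of_finite_support hfin p y).of_nonneg_of_le
    (fun k => firstExit_nonneg Gr W k p y) fun k => firstExit_le_killedTrans Gr W k p y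

/-- The first-exit kernel is nonnegative. [folklore] -/
theorem firstExitKernel_nonneg (Gr : SimpleGraph (Site d)) (W : Finset (Site d)) (p y : Site d) :
    0 ≤ firstExitKernel Gr W p y :=
  tsum_nonneg fun k => firstExit_nonneg Gr W k p y

/-- **Exit decomposition of the killed Green function** (strong Markov property at the exit time
of `W`): on a graph with finitely many non-isolated vertices, for a finite vertex set `W`,
`p ∈ W` and `q ∉ W`,
`G(p,q) = Σ_{y ∈ exitSet W} F_W(p,y) G(y,q)`.
Proof: sum the finite-time decomposition over `n` and use the Cauchy product of the nonnegative
summable series `Σ_k f_k(p,y)` and `Σ_m p_m(y,q)`. (Lawler–Limic 2010, §4.6; Lawler 1991, §1.5.)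
[folklore] -/
theorem killedGreen_eq_sum_firstExitKernel [NeZero d] {Gr : SimpleGraph (Site d)}
    (hfin : Gr.support.Finite) {W : Finset (Site d)} {p q : Site d} (hp : p ∈ W) (hq : q ∉ W) :
    killedGreen Gr p q = ∑ y ∈ exitSet W, firstExitKernel Gr W p y * killedGreen Gr y q := by
  have hf : ∀ y, Summable fun k => ‖firstExit Gr W k p y‖ := fun y => by
    simpa only [Real.norm_of_nonneg (firstExit_nonneg Gr W _ p y)] using summable_firstExit hfin W p y
  have hg : ∀ y, Summable fun m => ‖killedTrans Gr m y q‖ := fun y => by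
    simpa only [Real.norm_of_nonneg (killedTrans_nonneg Gr _ y q)] using
      summable_killedTrans_of_finite_support hfin y q
  have hprod : ∀ y, Summable fun n => ∑ k ∈ range (n + 1),
      firstExit Gr W k p y * killedTrans Gr (n - k) y q := fun y =>
    (summable_norm_sum_mul_range_of_summable_norm (hf y) (hg y)).of_norm
  calc killedGreen Gr p q
      = ∑' n, ∑ k ∈ range (n + 1), ∑ y ∈ exitSet W,
          firstExit Gr W k p y * killedTrans Gr (n - k) y q :=
        tsum_congr fun n => killedTrans_eq_sum_firstExit Gr hq n p (Or.inl hp)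
    _ = ∑' n, ∑ y ∈ exitSet W, ∑ k ∈ range (n + 1),
          firstExit Gr W k p y * killedTrans Gr (n - k) y q :=
        tsum_congr fun n => Finset.sum_comm
    _ = ∑ y ∈ exitSet W, ∑' n, ∑ k ∈ range (n + 1),
          firstExit Gr W k p y * killedTrans Gr (n - k) y q :=
        Summable.tsum_finsetSum fun y _ => hprod y
    _ = ∑ y ∈ exitSet W, firstExitKernel Gr W p y * killedGreen Gr y q := by
        refine Finset.sum_congr rfl fun y _ => ?_
        rw [firstExitKernel, killedGreen, tsum_mul_tsum_eq_tsum_sum_range_of_summable_norm (hf y) (hg y)]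

/-- **Ratio maximum principle, upper form.** If `G(y,q₁) ≤ M · G(y,q₂)` at every exit point
`y ∈ exitSet W` (with `q₁, q₂ ∉ W`), then `G(p,q₁) ≤ M · G(p,q₂)` at every `p ∈ W`: the supremum over
a finite set of the ratio of two killed Green functions with poles outside the set is attained on
its exit set. [folklore] -/
theorem killedGreen_le_mul_of_forall_exit [NeZero d] {Gr : SimpleGraph (Site d)}
    (hfin : Gr.support.Finite) {W : Finset (Site d)} {p q₁ q₂ : Site d} (hp : p ∈ W)
    (hq₁ : q₁ ∉ W) (hq₂ : q₂ ∉ W) {M : ℝ}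
    (hM : ∀ y ∈ exitSet W, killedGreen Gr y q₁ ≤ M * killedGreen Gr y q₂) :
    killedGreen Gr p q₁ ≤ M * killedGreen Gr p q₂ := by
  rw [killedGreen_eq_sum_firstExitKernel hfin hp hq₁, killedGreen_eq_sum_firstExitKernel hfin hp hq₂,
    Finset.mul_sum]
  refine Finset.sum_le_sum fun y hy => ?_
  calc firstExitKernel Gr W p y * killedGreen Gr y q₁
      ≤ firstExitKernel Gr W p y * (M * killedGreen Gr y q₂) :=
        mul_le_mul_of_nonneg_left (hM y hy) (firstExitKernel_nonneg Gr W p y)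
    _ = M * (firstExitKernel Gr W p y * killedGreen Gr y q₂) := by ring

/-- **Ratio maximum principle, lower form.** If `m · G(y,q₂) ≤ G(y,q₁)` at every exit point
`y ∈ exitSet W` (with `q₁, q₂ ∉ W`), then `m · G(p,q₂) ≤ G(p,q₁)` at every `p ∈ W`. [folklore] -/
theorem mul_killedGreen_le_of_forall_exit [NeZero d] {Gr : SimpleGraph (Site d)}
    (hfin : Gr.support.Finite) {W : Finset (Site d)} {p q₁ q₂ : Site d} (hp : p ∈ W)
    (hq₁ : q₁ ∉ W) (hq₂ : q₂ ∉ W) {m : ℝ}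
    (hm : ∀ y ∈ exitSet W, m * killedGreen Gr y q₂ ≤ killedGreen Gr y q₁) :
    m * killedGreen Gr p q₂ ≤ killedGreen Gr p q₁ := by
  rw [killedGreen_eq_sum_firstExitKernel hfin hp hq₁, killedGreen_eq_sum_firstExitKernel hfin hp hq₂,
    Finset.mul_sum]
  refine Finset.sum_le_sum fun y hy => ?_
  calc m * (firstExitKernel Gr W p y * killedGreen Gr y q₂)
      = firstExitKernel Gr W p y * (m * killedGreen Gr y q₂) := by ring
    _ ≤ firstExitKernel Gr W p y * killedGreen Gr y q₁ :=
        mul_le_mul_of_nonneg_left (hm y hy) (firstExitKernel_nonneg Gr W p y)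

end SRW

end Literature.Probability.LatticeModels
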